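import Summits.Ventures.HodgeRepro2.T6N43Places

/-!
# T6N43Lfac — the three archimedean L-factors of N4.3 re-pointed at the global datum's local factors (Tier 6, M2; t6-p6)

The M2 composition carrier (the lead's `NSide`, STATUS l. 4925 (3)) holds t6-p4's doubling-L datum
`d41` (with its local factors `d41.Lv v`) and t6-p6's bundle `d43 : N43Places` (with the per-place
`Lfac` fields the displays `Hyp.EischenLiu2024_Sec2_2` are stated on), and identifies the two by THREE
compat Prop fields `Lv_arch_j : d41.Lv (Sum.inr j) = d43.d_j.Lfac` (residual class IR, owners t6-p4 /
t6-p6). This file makes that identification hold BY CONSTRUCTION instead: `N43Places.withLfac D L`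
replaces the three `Lfac` fields of `D` by a given family `L : Fin 3 → ℂ → ℂ` (everything else — the
groups, measures, matrices, coefficients, norms, weights — unchanged), so that a carrier which sets
`L j := d41.Lv (Sum.inr j)` consumes THEOREM N4.3 in the form `N43_places_withLfac` below, whose
Eischen–Liu binders are stated DIRECTLY on the global datum's archimedean factors `L j`, and the three
compat fields disappear (`(D.withLfac L).d_j.Lfac = L j` is `rfl`). The zeta integrals do not see the
L-factor (`zetaAt_withLfac`), and the interface Props / the Rühl display transfer verbatim
(`fockLineIdentification_withLfac`, …). No display is declared here. §8(d): uses an L-value-free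
non-vanishing device: NO.
-/

namespace Summit.Ventures.HodgeRepro2.T6

open MeasureTheory Complex

namespace ArchDoublingDatum

variable {H : Type*} [MeasurableSpace H] {P : Matrix (Fin 2) (Fin 2) ℂ → Prop}

/-- The datum with its archimedean L-factor field replaced by `L` (all other fields unchanged). -/
def withLfac (𝒟 : ArchDoublingDatum H P) (L : ℂ → ℂ) : ArchDoublingDatum H P :=
  { 𝒟 with Lfac := L }

/-- The replaced factor is `L`. -/
theorem withLfac_Lfac (𝒟 : ArchDoublingDatum H P) (L : ℂ → ℂ) : (𝒟.withLfac L).Lfac = L := rfl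

/-- The zeta integral does not see the L-factor. -/
theorem withLfac_zeta (𝒟 : ArchDoublingDatum H P) (L : ℂ → ℂ) : (𝒟.withLfac L).zeta = 𝒟.zeta := rfl

/-- `Z^*` of the re-pointed datum: the same integral divided by the new factor. -/
theorem withLfac_zetaStar (𝒟 : ArchDoublingDatum H P) (L : ℂ → ℂ) (s : ℂ) :
    (𝒟.withLfac L).zetaStar s = 𝒟.zeta s / L (s + 1 / 2) := rfl

/-- (I-P2) transfers verbatim. -/
theorem withLfac_fockLineIdentification (𝒟 : ArchDoublingDatum H P) (L : ℂ → ℂ) :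
    (𝒟.withLfac L).FockLineIdentification ↔ 𝒟.FockLineIdentification := Iff.rfl

/-- (I-P2′) transfers verbatim. -/
theorem withLfac_lowestWeightCoefficient (𝒟 : ArchDoublingDatum H P) (L : ℂ → ℂ) :
    (𝒟.withLfac L).LowestWeightCoefficient ↔ 𝒟.LowestWeightCoefficient := Iff.rfl

/-- (I-P2) at the compact place transfers verbatim. -/
theorem withLfac_characterCoefficient (𝒟 : ArchDoublingDatum H P) (L : ℂ → ℂ) (m : ℤ) :
    (𝒟.withLfac L).CharacterCoefficient m ↔ 𝒟.CharacterCoefficient m := Iff.rfl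

/-- The Rühl (A-2f) display transfers verbatim (it speaks of `μ` and `eta` only). -/
theorem withLfac_ruhl_A2f (𝒟 : ArchDoublingDatum H T5UnitaryBound.MemU11) (L : ℂ → ℂ) :
    Hyp.Ruhl1970_A2f (𝒟.withLfac L) ↔ Hyp.Ruhl1970_A2f 𝒟 := Iff.rfl

end ArchDoublingDatum

namespace N43Places

/-- The bundle with its three archimedean L-factors replaced by `L 0, L 1, L 2` (everything else
unchanged) — the form in which a composition carrier points N4.3 at the archimedean factors of ITS
global doubling L-function. -/
def withLfac (D : N43Places) (L : Fin 3 → ℂ → ℂ) : N43Places :=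
  { D with d₁ := D.d₁.withLfac (L 0), d₂ := D.d₂.withLfac (L 1), d₃ := D.d₃.withLfac (L 2) }

variable (D : N43Places) (L : Fin 3 → ℂ → ℂ)

/-- The re-pointed factor at τ′₁. -/
theorem withLfac_d₁_Lfac : (D.withLfac L).d₁.Lfac = L 0 := rfl
/-- The re-pointed factor at τ′₂. -/
theorem withLfac_d₂_Lfac : (D.withLfac L).d₂.Lfac = L 1 := rfl
/-- The re-pointed factor at τ′₃. -/
theorem withLfac_d₃_Lfac : (D.withLfac L).d₃.Lfac = L 2 := rfl

/-- The zeta integrals do not see the L-factors. -/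
theorem zetaAt_withLfac : (D.withLfac L).zetaAt = D.zetaAt := by
  funext j; fin_cases j <;> rfl

/-- `Z^*_{τ′_j}(1/2)` of the re-pointed bundle is `Z_{τ′_j}(1/2) / L j 1`. -/
theorem zetaStarAt_withLfac (j : Fin 3) :
    (D.withLfac L).zetaStarAt j = D.zetaAt j / L j (1 / 2 + 1 / 2) := by
  fin_cases j <;> rfl

/-- THEOREM N4.3 (a)–(c) at all three places with the Eischen–Liu displays stated on the GIVEN family
`L` of archimedean factors (the global datum's `Lv` at the real places): the same binders as
`N43_places`, the L-factor binders on `L j` instead of the bundle's own `Lfac` fields. -/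
theorem N43_places_withLfac
    (hP2₁ : D.d₁.CharacterCoefficient D.m)
    (hEL₁ : Hyp.EischenLiu2024_Sec2_2 2 0 D.τ₁ D.ν₁ D.r₁ (L 0))
    (hP2₂ : D.d₂.FockLineIdentification) (hP2'₂ : D.d₂.LowestWeightCoefficient)
    (hA2f₂ : Hyp.Ruhl1970_A2f D.d₂)
    (hEL₂ : Hyp.EischenLiu2024_Sec2_2 1 1 D.τ₂ D.ν₂ D.r₂ (L 1))
    (hP2₃ : D.d₃.FockLineIdentification) (hP2'₃ : D.d₃.LowestWeightCoefficient)
    (hA2f₃ : Hyp.Ruhl1970_A2f D.d₃)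
    (hEL₃ : Hyp.EischenLiu2024_Sec2_2 1 1 D.τ₃ D.ν₃ D.r₃ (L 2)) :
    (∀ j : Fin 3, 0 < ((D.withLfac L).zetaAt j).re) ∧ (D.withLfac L).ArchNonvanishing :=
  (D.withLfac L).N43_places hP2₁ hEL₁ hP2₂ hP2'₂ hA2f₂ hEL₂ hP2₃ hP2'₃ hA2f₃ hEL₃

/-- The archimedean non-vanishing alone, on the re-pointed bundle. -/
theorem archNonvanishing_withLfac
    (hP2₁ : D.d₁.CharacterCoefficient D.m)
    (hEL₁ : Hyp.EischenLiu2024_Sec2_2 2 0 D.τ₁ D.ν₁ D.r₁ (L 0))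
    (hP2₂ : D.d₂.FockLineIdentification) (hP2'₂ : D.d₂.LowestWeightCoefficient)
    (hA2f₂ : Hyp.Ruhl1970_A2f D.d₂)
    (hEL₂ : Hyp.EischenLiu2024_Sec2_2 1 1 D.τ₂ D.ν₂ D.r₂ (L 1))
    (hP2₃ : D.d₃.FockLineIdentification) (hP2'₃ : D.d₃.LowestWeightCoefficient)
    (hA2f₃ : Hyp.Ruhl1970_A2f D.d₃)
    (hEL₃ : Hyp.EischenLiu2024_Sec2_2 1 1 D.τ₃ D.ν₃ D.r₃ (L 2)) :
    (D.withLfac L).ArchNonvanishing :=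
  (D.N43_places_withLfac L hP2₁ hEL₁ hP2₂ hP2'₂ hA2f₂ hEL₂ hP2₃ hP2'₃ hA2f₃ hEL₃).2

/-- The toy bundle re-pointed at its own factors is itself (non-vacuity of the re-pointed form). -/
theorem toy_withLfac_archNonvanishing :
    (toy.withLfac fun j => match j with | 0 => toy.d₁.Lfac | 1 => toy.d₂.Lfac | 2 => toy.d₃.Lfac).ArchNonvanishing :=
  toy.archNonvanishing_withLfac _ N43Toy.toyU2_char N43Toy.toyU2_EL N43Toy.toyU11_fock
    N43Toy.toyU11_lowest N43Toy.toyU11_A2f N43Toy.toyU11_EL N43Toy.toyU11_fock N43Toy.toyU11_lowest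
    N43Toy.toyU11_A2f N43Toy.toyU11_EL

end N43Places

end Summit.Ventures.HodgeRepro2.T6
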